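import Summits.ResolutionOfSingularities.ResolutionOfSingularities.Theorems.HomologicalConductorNoZenoSplitCountBaseChange
import HarnessLib

/-!
# Crux `NoZenoR` / `NoZeno` (stmt-ResolutionOfSingularities-19943 / -16483), β2 descent, `stub_L1wCore` (F1) route,
# BC-2c: after a base change that SPLITS the separable constant fields, every split weight is `1`

OURS (cell res-hironaka, chain W4.4; stub worker res-L0-w44-stub-2 g12; brick DAG `L1W-PREP-v2.md` 95253e48ec58b05c
§2.1 D3 «all split weights 1 upstairs (κ₁ splits)», sequel to `…NoZenoSplitCountBaseChange`).  Nothing here is a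
statement of the manuscript under review (Hironaka 2017); AI-written, weaker than expert review.

Algebra (`SplitFieldFibre`, setting of `…NoZenoSplitFieldFibre`: `A = K' ⊗_κ F`, `M = K' ⊗_κ L`, `L` finite separable
over `κ` and separably closed in `F`):
* `SplitFieldFibre.finrank_quotient_eq_one_of_splits` — if `K'` splits the minimal polynomial of every element
  of `L`, every residue field `M/𝔪` of `M = K' ⊗_κ L` is `K'` itself (`[M/𝔪 : K'] = 1`);
* `SplitFieldFibre.finrank_separableClosure_residueField_eq_one_of_splits` — hence every split weight of
  `Spec (K' ⊗_κ F)` is `1` (with L := `separableClosure κ F`, `h0 := separableClosure.separableClosure_eq_bot κ F`).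

Schemes (`π : X → Spec R`, `g : Spec R_B → Spec R`, `X_B = X ×_{Spec R} Spec R_B`, `σ = pullback.fst`,
`π_B = pullback.snd`):
* `finrank_weight_eq_of_ringEquiv` — point-wise form of `finsum_weight_eq_of_ringEquiv`;
* `splitWeight_specTensorTo_eq_one` (triplet form), **`splitWeight_eq_one_of_fst_eq`** — if `κ(𝔪_{R_B})` splits the
  separable constant field `κ(η)^s` of a point `η` of the closed fibre (finite separable `κ(𝔪_{R_B})/κ(𝔪_R)`,
  honest weight at `η`), every point of `X_B` over `η` has split weight `1`;
* **`ncard_excCurvePoints_pullback_snd`** — if this holds at every integral exceptional curve of `π` (finitely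
  many), then `(excCurvePoints π_B).ncard = splitExcCount π_B = splitExcCount π`: upstairs the plain count IS the
  split count (D3 of the (F1) descent).
-/

noncomputable section

-- single-problem summit: the doubled namespace component `ResolutionOfSingularities` is forced
set_option linter.dupNamespace false

namespace Summit.ResolutionOfSingularities.ResolutionOfSingularities.Theorems.NoZeno.ExcCount

open CategoryTheory CategoryTheory.Limits AlgebraicGeometry AlgebraicGeometry.Scheme.Pullback IsLocalRing TensorProduct
  Polynomial
open Literature.AlgebraicGeometry.Resolution

/-! ## Algebra: splitting base ⇒ all residue fields of `K' ⊗_κ L` are `K'` -/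

namespace SplitFieldFibre

variable (κ K' F L : Type*) [Field κ] [Field K'] [Field F] [Field L] [Algebra κ K'] [Algebra κ F] [Algebra κ L]
  [Algebra L F] [IsScalarTower κ L F]

/-- **If `K'` splits `L`, every residue field of `K' ⊗_κ L` is `K'`**: for `L/κ` finite and `K'/κ` such that the
minimal polynomial of every element of `L` splits in `K'`, `[ (K' ⊗_κ L)/𝔪 : K' ] = 1` for every maximal `𝔪`
(the field `M/𝔪` is generated over `K'` by the image of `L`, whose elements have their conjugates in `K'`).
[this work] -/
theorem finrank_quotient_eq_one_of_splits [FiniteDimensional κ L]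
    (hsplit : ∀ x : L, ((minpoly κ x).map (algebraMap κ K')).Splits) (𝔪 : Ideal (K' ⊗[κ] L)) [𝔪.IsMaximal] :
    letI := Ideal.Quotient.field 𝔪
    Module.finrank K' ((K' ⊗[κ] L) ⧸ 𝔪) = 1 := by
  letI := Ideal.Quotient.field 𝔪
  letI : Algebra L (K' ⊗[κ] L) := Algebra.TensorProduct.rightAlgebra
  -- every class of `k ⊗ ℓ` lies in the image of `K'`
  have hL : ∀ ℓ : L, algebraMap L ((K' ⊗[κ] L) ⧸ 𝔪) ℓ ∈ (algebraMap K' ((K' ⊗[κ] L) ⧸ 𝔪)).range := by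
    intro ℓ
    have hint : IsIntegral κ (algebraMap L ((K' ⊗[κ] L) ⧸ 𝔪) ℓ) := (Algebra.IsIntegral.isIntegral ℓ).algebraMap
    refine hint.mem_range_algebraMap_of_minpoly_splits ?_
    rw [minpoly.algebraMap_eq (algebraMap L ((K' ⊗[κ] L) ⧸ 𝔪)).injective]
    exact hsplit ℓ
  have hsurj : Function.Surjective (algebraMap K' ((K' ⊗[κ] L) ⧸ 𝔪)) := by
    rw [← RingHom.range_eq_top, eq_top_iff]
    rintro y -
    obtain ⟨a, rfl⟩ := Ideal.Quotient.mk_surjective y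
    induction a using TensorProduct.induction_on with
    | zero => rw [map_zero]; exact Subring.zero_mem _
    | tmul k x =>
      rw [tmul_eq_algebraMap_mul κ K' L, map_mul]
      refine Subring.mul_mem _ ⟨k, ?_⟩ ?_
      · rw [← Ideal.Quotient.algebraMap_eq, ← IsScalarTower.algebraMap_apply]
      · rw [← Ideal.Quotient.algebraMap_eq, ← IsScalarTower.algebraMap_apply]
        exact hL x
    | add a a' ha ha' => rw [map_add]; exact Subring.add_mem _ ha ha'
  let e : K' ≃ₗ[K'] ((K' ⊗[κ] L) ⧸ 𝔪) :=
    LinearEquiv.ofBijective (Algebra.linearMap K' ((K' ⊗[κ] L) ⧸ 𝔪))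
      ⟨(algebraMap K' ((K' ⊗[κ] L) ⧸ 𝔪)).injective, hsurj⟩
  rw [← e.finrank_eq, Module.finrank_self]

/-- **Splitting base ⇒ every split weight of the fibre is `1`**: for `K'/κ` finite separable splitting the finite
separable `L ⊆ F` (`L` separably closed in `F`, i.e. `L = κ^s ∩ F`), `[κ(p)^s : K'] = 1` for every prime `p` of
`K' ⊗_κ F`. (Apply with `L := separableClosure κ F`, `h0 := separableClosure.separableClosure_eq_bot κ F`.)
[this work] -/
theorem finrank_separableClosure_residueField_eq_one_of_splits [Algebra.IsSeparable κ K'] [FiniteDimensional κ K']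
    [FiniteDimensional κ L] [Algebra.IsSeparable κ L] (h0 : separableClosure L F = ⊥)
    (hsplit : ∀ x : L, ((minpoly κ x).map (algebraMap κ K')).Splits) (p : PrimeSpectrum (K' ⊗[κ] F)) :
    Module.finrank K' (separableClosure K' p.asIdeal.ResidueField) = 1 := by
  obtain ⟨𝔪, h𝔪⟩ := (map_bijective κ K' F L h0).2 p
  subst h𝔪
  haveI := 𝔪.isMaximal
  have h1 := finrank_separableClosure_residueField_eq_quotient κ K' F L h0
    ⟨𝔪.asIdeal.map (Algebra.TensorProduct.map (AlgHom.id K' K') (IsScalarTower.toAlgHom κ L F)),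
      (isMaximal_map κ K' F L h0 𝔪.asIdeal).isPrime⟩
  have h2 := finrank_separableClosure_quotient_map_eq κ K' F L h0 𝔪.asIdeal
  rw [h1.trans h2]
  exact finrank_quotient_eq_one_of_splits κ K' L hsplit 𝔪.asIdeal

end SplitFieldFibre

/-! ## Point-wise transport of the weight along a ring isomorphism -/

section Algebra

/-- Point-wise form of `finsum_weight_eq_of_ringEquiv`: `[κ(p)^s : K] = [κ(E p)^s : K]` for a `K`-compatible ring
isomorphism `E : A ≃ B` (`E p := PrimeSpectrum.comapEquiv E p`). [folklore] -/
theorem finrank_weight_eq_of_ringEquiv {K A B : Type*} [Field K] [CommRing A] [CommRing B] (iA : K →+* A)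
    (iB : K →+* B) (E : A ≃+* B) (hE : ∀ k, E (iA k) = iB k) (p : PrimeSpectrum A) :
    (letI := ((algebraMap A p.asIdeal.ResidueField).comp iA).toAlgebra;
        Module.finrank K (separableClosure K p.asIdeal.ResidueField)) =
      (letI := ((algebraMap B (PrimeSpectrum.comapEquiv E p).asIdeal.ResidueField).comp iB).toAlgebra;
        Module.finrank K (separableClosure K (PrimeSpectrum.comapEquiv E p).asIdeal.ResidueField)) := by
  have hpq : p.asIdeal = (PrimeSpectrum.comapEquiv E p).asIdeal.comap E.toRingHom := by
    have : p = PrimeSpectrum.comap E.toRingHom (PrimeSpectrum.comapEquiv E p) :=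
      ((PrimeSpectrum.comapEquiv E).symm_apply_apply p).symm
    conv_lhs => rw [this]
    rfl
  have hbij := (RingHom.surjectiveOnStalks_of_surjective E.surjective).residueFieldMap_bijective
    p.asIdeal (PrimeSpectrum.comapEquiv E p).asIdeal hpq
  exact finrank_separableClosure_eq_of_ringEquiv ((algebraMap A p.asIdeal.ResidueField).comp iA)
    ((algebraMap B (PrimeSpectrum.comapEquiv E p).asIdeal.ResidueField).comp iB) (RingEquiv.refl K)
    (RingEquiv.ofBijective _ hbij) fun k => by
      change Ideal.ResidueField.map p.asIdeal _ E.toRingHom hpq (algebraMap A _ (iA k)) = algebraMap B _ (iB k)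
      rw [Ideal.ResidueField.map_algebraMap]
      exact congrArg _ (hE k)

end Algebra

/-! ## Every point over a split curve has weight one -/

section Scheme

variable {R RB : Type} [CommRing R] [IsLocalRing R] [CommRing RB] [IsLocalRing RB]
  {X : Scheme.{0}} (π : X ⟶ Spec (.of R)) (g : Spec (.of RB) ⟶ Spec (.of R))

omit [IsLocalRing R] [IsLocalRing RB] in
/-- **Triplet form: splitting ⇒ weight one.** For a triplet `T = (x, y, s)` over `π`, `g` with `κ(y)/κ(s)` finite
separable, `[κ(x)^s : κ(s)] < ∞`, and `κ(y)` splitting the separable constant field `κ(x)^s` (all structure maps those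
of the triplet), every point `T.SpecTensorTo p` of `X_B` over `(x, y)` has split weight `1`. [this work] -/
theorem splitWeight_specTensorTo_eq_one (T : Triplet π g)
    (hfin : letI := (((Spec (.of R)).residueFieldCongr T.hy).inv ≫ g.residueFieldMap T.y).hom.toAlgebra
      Module.Finite ((Spec (.of R)).residueField T.s) ((Spec (.of RB)).residueField T.y))
    (hsep : letI := (((Spec (.of R)).residueFieldCongr T.hy).inv ≫ g.residueFieldMap T.y).hom.toAlgebra
      Algebra.IsSeparable ((Spec (.of R)).residueField T.s) ((Spec (.of RB)).residueField T.y))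
    (hFW : letI := (((Spec (.of R)).residueFieldCongr T.hx).inv ≫ π.residueFieldMap T.x).hom.toAlgebra
      FiniteDimensional ((Spec (.of R)).residueField T.s)
        (separableClosure ((Spec (.of R)).residueField T.s) (X.residueField T.x)))
    (hsplit : letI := (((Spec (.of R)).residueFieldCongr T.hx).inv ≫ π.residueFieldMap T.x).hom.toAlgebra
      letI := (((Spec (.of R)).residueFieldCongr T.hy).inv ≫ g.residueFieldMap T.y).hom.toAlgebra
      ∀ x : separableClosure ((Spec (.of R)).residueField T.s) (X.residueField T.x),
        ((minpoly ((Spec (.of R)).residueField T.s) x).map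
          (algebraMap ((Spec (.of R)).residueField T.s) ((Spec (.of RB)).residueField T.y))).Splits)
    (p : Spec T.tensor) : splitWeight (pullback.snd π g) (T.SpecTensorTo p) = 1 := by
  letI iF : Algebra ((Spec (.of R)).residueField T.s) (X.residueField T.x) :=
    (((Spec (.of R)).residueFieldCongr T.hx).inv ≫ π.residueFieldMap T.x).hom.toAlgebra
  letI iK : Algebra ((Spec (.of R)).residueField T.s) ((Spec (.of RB)).residueField T.y) :=
    (((Spec (.of R)).residueFieldCongr T.hy).inv ≫ g.residueFieldMap T.y).hom.toAlgebra
  haveI : Module.Finite ((Spec (.of R)).residueField T.s) ((Spec (.of RB)).residueField T.y) := hfin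
  haveI : Algebra.IsSeparable ((Spec (.of R)).residueField T.s) ((Spec (.of RB)).residueField T.y) := hsep
  haveI : FiniteDimensional ((Spec (.of R)).residueField T.s)
      (separableClosure ((Spec (.of R)).residueField T.s) (X.residueField T.x)) := hFW
  haveI : Algebra.IsSeparable ((Spec (.of R)).residueField T.s)
      (separableClosure ((Spec (.of R)).residueField T.s) (X.residueField T.x)) :=
    separableClosure.isSeparable _ _
  haveI := isMaximal_of_finite T hfin p
  -- (1) the weight is computed in `T.tensor`
  unfold splitWeight
  rw [finrank_separableClosure_residueField_specTensorTo T p]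
  -- (2) transport along `T.tensor ≅ κ(x) ⊗ κ(y) ≅ κ(y) ⊗ κ(x)`
  obtain ⟨e, -, he⟩ := exists_tensorIso T
  let E : T.tensor ≃+* ((Spec (.of RB)).residueField T.y) ⊗[(Spec (.of R)).residueField T.s]
      (X.residueField T.x) :=
    e.commRingCatIsoToRingEquiv.trans (Algebra.TensorProduct.comm _ _ _).toRingEquiv
  have hE : ∀ k, E (T.tensorInr.hom k) = algebraMap ((Spec (.of RB)).residueField T.y)
      (((Spec (.of RB)).residueField T.y) ⊗[(Spec (.of R)).residueField T.s] (X.residueField T.x)) k := by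
    intro k
    have h1 : e.hom.hom (T.tensorInr.hom k) = (1 : X.residueField T.x) ⊗ₜ k := by
      have := congrArg (fun φ => φ.hom k) he
      simp only [CommRingCat.hom_comp, RingHom.comp_apply, CommRingCat.hom_ofHom] at this
      exact this
    change (Algebra.TensorProduct.comm _ _ _) (e.hom.hom (T.tensorInr.hom k)) = k ⊗ₜ 1
    rw [h1, Algebra.TensorProduct.comm_tmul]
  rw [finrank_weight_eq_of_ringEquiv T.tensorInr.hom _ E hE p]
  -- (3) the weight of the corresponding prime `q` of `κ(y) ⊗ κ(x)` is `1` by the algebra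
  have hirr := finrank_separableClosure_algebra_irrel
    ((algebraMap (((Spec (.of RB)).residueField T.y) ⊗[(Spec (.of R)).residueField T.s] (X.residueField T.x)) (PrimeSpectrum.comapEquiv E p).asIdeal.ResidueField).comp
      (algebraMap ((Spec (.of RB)).residueField T.y) (((Spec (.of RB)).residueField T.y) ⊗[(Spec (.of R)).residueField T.s] (X.residueField T.x)))).toAlgebra
    (inferInstance : Algebra ((Spec (.of RB)).residueField T.y) (PrimeSpectrum.comapEquiv E p).asIdeal.ResidueField)
    (fun k => (IsScalarTower.algebraMap_apply ((Spec (.of RB)).residueField T.y) (((Spec (.of RB)).residueField T.y) ⊗[(Spec (.of R)).residueField T.s] (X.residueField T.x))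
      (PrimeSpectrum.comapEquiv E p).asIdeal.ResidueField k).symm)
  have hq := SplitFieldFibre.finrank_separableClosure_residueField_eq_one_of_splits ((Spec (.of R)).residueField T.s) ((Spec (.of RB)).residueField T.y) (X.residueField T.x)
    (separableClosure ((Spec (.of R)).residueField T.s) (X.residueField T.x)) (separableClosure.separableClosure_eq_bot _ _) hsplit
    (PrimeSpectrum.comapEquiv E p)
  rw [hirr, hq]
  exact max_self 1

variable (hg : g.base ⁻¹' {closedPoint R} = {closedPoint RB})

include hg in
/-- **Splitting ⇒ weight one over `η`.** For `g : Spec R_B → Spec R` with `g ⁻¹' {𝔪_R} = {𝔪_{R_B}}` (and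
`hy : g 𝔪_{R_B} = π η`, which follows), `κ(𝔪_{R_B})/κ(π η)` finite separable, a point `η` of the closed fibre with
honest weight whose separable constant field `κ(η)^s` SPLITS in `κ(𝔪_{R_B})`: every point `ζ` of `X_B` over `η`
has `splitWeight π_B ζ = 1`. [this work] -/
theorem splitWeight_eq_one_of_fst_eq (η : X) (hη : π.base η = closedPoint R) (hy : g.base (closedPoint RB) = π.base η)
    (hfin : letI := (((Spec (.of R)).residueFieldCongr hy).inv ≫ g.residueFieldMap (closedPoint RB)).hom.toAlgebra
      Module.Finite ((Spec (.of R)).residueField (π.base η)) ((Spec (.of RB)).residueField (closedPoint RB)))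
    (hsep : letI := (((Spec (.of R)).residueFieldCongr hy).inv ≫ g.residueFieldMap (closedPoint RB)).hom.toAlgebra
      Algebra.IsSeparable ((Spec (.of R)).residueField (π.base η)) ((Spec (.of RB)).residueField (closedPoint RB)))
    (hFW : letI := (π.residueFieldMap η).hom.toAlgebra
      FiniteDimensional ((Spec (.of R)).residueField (π.base η))
        (separableClosure ((Spec (.of R)).residueField (π.base η)) (X.residueField η)))
    (hsplit : letI := (π.residueFieldMap η).hom.toAlgebra
      letI := (((Spec (.of R)).residueFieldCongr hy).inv ≫ g.residueFieldMap (closedPoint RB)).hom.toAlgebra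
      ∀ x : separableClosure ((Spec (.of R)).residueField (π.base η)) (X.residueField η),
        ((minpoly ((Spec (.of R)).residueField (π.base η)) x).map (algebraMap ((Spec (.of R)).residueField
          (π.base η)) ((Spec (.of RB)).residueField (closedPoint RB)))).Splits)
    (ζ : ↑(pullback π g)) (hζ : pullback.fst π g ζ = η) : splitWeight (pullback.snd π g) ζ = 1 := by
  -- `κ(π η) → κ(η)` through `π.residueFieldMap η` and through the triplet's `(congr rfl).inv ≫ π.residueFieldMap η`:
  -- the same `Algebra` structure
  have halg : (((Spec (.of R)).residueFieldCongr (rfl : π.base η = π.base η)).inv ≫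
      π.residueFieldMap η).hom.toAlgebra = (π.residueFieldMap η).hom.toAlgebra := by
    refine Algebra.algebra_ext _ _ fun k => ?_
    change (((Spec (.of R)).residueFieldCongr (rfl : π.base η = π.base η)).inv ≫ π.residueFieldMap η).hom k =
      (π.residueFieldMap η).hom k
    simp [Scheme.residueFieldCongr_refl]
  obtain ⟨p, rfl⟩ := exists_specTensorTo_eq (⟨η, closedPoint RB, π.base η, rfl, hy⟩ : Triplet π g) ζ hζ
    (snd_eq_closedPoint_of_fst π g hg ζ (by rw [hζ, hη]))
  refine splitWeight_specTensorTo_eq_one π g ⟨η, closedPoint RB, π.base η, rfl, hy⟩ hfin hsep ?_ ?_ p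
  · change letI := (((Spec (.of R)).residueFieldCongr (rfl : π.base η = π.base η)).inv ≫
        π.residueFieldMap η).hom.toAlgebra
      FiniteDimensional ((Spec (.of R)).residueField (π.base η))
        (separableClosure ((Spec (.of R)).residueField (π.base η)) (X.residueField η))
    rw [halg]
    exact hFW
  · change letI := (((Spec (.of R)).residueFieldCongr (rfl : π.base η = π.base η)).inv ≫
        π.residueFieldMap η).hom.toAlgebra
      letI := (((Spec (.of R)).residueFieldCongr hy).inv ≫ g.residueFieldMap (closedPoint RB)).hom.toAlgebra
      ∀ x : separableClosure ((Spec (.of R)).residueField (π.base η)) (X.residueField η),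
        ((minpoly ((Spec (.of R)).residueField (π.base η)) x).map (algebraMap ((Spec (.of R)).residueField
          (π.base η)) ((Spec (.of RB)).residueField (closedPoint RB)))).Splits
    rw [halg]
    exact hsplit

include hg in
/-- **D3 count line: upstairs the plain count is the split count.** If moreover every integral exceptional curve
of `π` (finitely many, honest weights) has its separable constant field split by `κ(𝔪_{R_B})`, then every split
weight of `π_B` is `1` and `(excCurvePoints π_B).ncard = splitExcCount π_B = splitExcCount π`. [this work] -/
theorem ncard_excCurvePoints_pullback_snd [IsFinite g] (hy : g.base (closedPoint RB) = closedPoint R)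
    (hfin : letI := (g.residueFieldMap (closedPoint RB)).hom.toAlgebra
      Module.Finite ((Spec (.of R)).residueField (g.base (closedPoint RB)))
        ((Spec (.of RB)).residueField (closedPoint RB)))
    (hsep : letI := (g.residueFieldMap (closedPoint RB)).hom.toAlgebra
      Algebra.IsSeparable ((Spec (.of R)).residueField (g.base (closedPoint RB)))
        ((Spec (.of RB)).residueField (closedPoint RB)))
    (hfinπ : (excCurvePoints π).Finite)
    (hFW : ∀ η ∈ excCurvePoints π, letI := (π.residueFieldMap η).hom.toAlgebra
      FiniteDimensional ((Spec (.of R)).residueField (π.base η))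
        (separableClosure ((Spec (.of R)).residueField (π.base η)) (X.residueField η)))
    (hsplit : ∀ (η : X) (hη : η ∈ excCurvePoints π), letI := (π.residueFieldMap η).hom.toAlgebra
      letI := (((Spec (.of R)).residueFieldCongr (hy.trans hη.1.symm)).inv ≫
        g.residueFieldMap (closedPoint RB)).hom.toAlgebra
      ∀ x : separableClosure ((Spec (.of R)).residueField (π.base η)) (X.residueField η),
        ((minpoly ((Spec (.of R)).residueField (π.base η)) x).map (algebraMap ((Spec (.of R)).residueField
          (π.base η)) ((Spec (.of RB)).residueField (closedPoint RB)))).Splits) :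
    (∀ ζ ∈ excCurvePoints (pullback.snd π g), splitWeight (pullback.snd π g) ζ = 1) ∧
      (excCurvePoints (pullback.snd π g)).ncard = splitExcCount (pullback.snd π g) ∧
      splitExcCount (pullback.snd π g) = splitExcCount π := by
  have hone : ∀ ζ ∈ excCurvePoints (pullback.snd π g), splitWeight (pullback.snd π g) ζ = 1 := by
    intro ζ hζ
    rw [excCurvePoints_pullback_snd π g hg] at hζ
    have hη : pullback.fst π g ζ ∈ excCurvePoints π := hζ
    exact splitWeight_eq_one_of_fst_eq π g hg (pullback.fst π g ζ) hη.1 (hy.trans hη.1.symm)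
      (finite_of_residueFieldCongr g (closedPoint RB) _ hfin)
      (isSeparable_of_residueFieldCongr g (closedPoint RB) _ hsep) (hFW _ hη) (hsplit _ hη) ζ rfl
  refine ⟨hone, ?_, splitExcCount_pullback_snd π g hg hfin hsep hfinπ hFW⟩
  unfold splitExcCount
  rw [finsum_mem_congr rfl hone, finsum_one]

end Scheme

end Summit.ResolutionOfSingularities.ResolutionOfSingularities.Theorems.NoZeno.ExcCount

end
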